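import Summits.QuantumFields.BalabanUV.Beta.GAN24.HalfMemberSlavedDivergenceComb
import Summits.QuantumFields.BalabanUV.Beta.SpineRecursivePureParity

/-!
# `BalabanUV.Beta.GAN24.HalfMemberSlavedDivergencePin` — binder row G-an2-4 ∕ (CONV-C), W-slot EXIT (α) ((α-END-b1) «THE EVEN MEMBER's SLAVED DIVERGENCE»,
# the OWNER gan24-p1 g33's W9 l.49725), PART 3 of `HalfMemberSlavedDivergence`: **THE EVEN MEMBER's SLAVED DIVERGENCE AT D1's LITERAL TABLE LAWS, THE LITERAL
# LETTERS' PARITIES DISCHARGED BY NAME** — the commutator word is EVEN because the pure first-order table `SpureRecAt` is odd-rowed (leaf-05's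
# `SpineRecursivePureParity.trK_SpureRecAt` ⨾ PART 1 `parityEven_comm_of_oddRows`), the `𝒩`-word of the remainder is ODD because `𝒩` is (an1's sandwich
# `SpineRecursiveParity.parityOdd_sandwich` on the sgn-symmetric co-dressed resolvent `BubbleParity.trK_coDressKBmAt_KInvStep` ⨾ `parityOdd_mmRead ∕ _sum ∕ _smul ∕ _add`);
# what stays displayed is D1's own hypotheses (`h𝒩 hWd hlock hBord hBord″` at level `m+1`, the Wilson ∕ border letters at level `0`) PLUS the parity letters of
# `𝒩` and of the border ∕ Wilson remainders (`h𝒩par`, `hRB hRB″`, `hRW hRW″`)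
# (G-an2-4 FORMAL swarm → CRUX TEAM (2), leaf-01 lineage `b2b-balaban-gan24-formalise-leaf-01`, gen 72)

NOT IN PRINT; OUR BOOKKEEPING ([folklore] composition BY NAME; 0 `def`, 0 cited facts, 0 `def … : Prop`, 0 sorry).  HONEST FRAMING (cell contract, verbatim):
«discharging `BetaPertH` makes Bałaban's UV stability UNCONDITIONAL — a real constructive-QFT result; it is NOT the continuum limit and NOT the Clay problem.»
HONEST DEPENDENCY (verbatim): «continuum YM on T⁴ ⇐ BetaPertH ∧ nine spine estimates (0/9 proved); BetaPertH ⇐ (D1) ∧ (D4) ∧ CAP+tail; G-an2-4 gates asym, D1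
and NE2/3/4.»

WHAT (pin `(cE, cVH) = (Lc^{d+1}, −Lc^{d+1}·½·Lc^{d+1})` as in D1's `WardLocusQuarticTable` and leaf-06's `T2SlavedDivergence` §4; even member `T♮̃^{ev}_j := ½ • (T♮̃_j + P T♮̃_j)`,
junction spelling; `X_y := diagK (½ • Σ_{v∈box} legInd ρ (Lc•y + v))`; in-block root, `1 ≤ Lc`, border data `hBff hBmm hB`; generic `d`):
* **`divW_evenMember_succ_succ_eq_slaved`** — LEVEL `m+1 → m+2`: under D1's `tableLaw_T2RecAt_succ ∕ ''` hypotheses (`h𝒩 hWd hlock hBord hBord″`, displayed verbatim), `cH′ ≠ 0`,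
  and the parity letters `h𝒩par : ∀ y ν y′, trK (𝒩 y ν y′) = −sgnK (𝒩 y ν y′)` (p2's `WardResidualParity` §3 at the literal `𝒩`), `hRB hRB″` (the border remainders odd):
  `divW (T♮̃^{ev}_{m+2}) y ν y′ = divW (b♮̃^{ev}_{m+1}) y ν y′ + (c₄·(Lc^{d+1})⁻¹∕2) • (e3OfK Lc K♮ᴱ_{m+1} [(sf·sm)⁻¹ • unitS (κ′u′ ↦ cH′⁻¹ • (S_{m+1} κ′u′ ∘ X_y − X_y ∘ S_{m+1} κ′u′))] ν y′
  + the ″ twin)`, `S_{m+1} = SpureRecAt … (m+1)` — NO `𝒩`, NO `RB`: THE EVEN MEMBER's DIVERGENCE ONE LEVEL UP DOES NOT SEE THE WARD-LOCUS RESIDUAL.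
* **`divW_evenMember_one_eq_slaved`** — LEVEL `0 → 1`: under D1's `tableLaw_T2RecAt_zero ∕ ''` letters (`hWil hBord hWil″ hBord″`, remainders `RW RB RW″ RB″`) and their
  parities `hRW hRB hRW″ hRB″`: the same with `S_0`.
PART 2's `divW_evenMember_succ_eq_slaved` with `hTL ∕ hTL″` := D1's theorems, `hC` := `parityEven_comm_of_oddRows (trK_SpureRecAt …)`, `hR ∕ hR″` := the parity algebra above.
Asserts NOTHING about Bałaban's tables; 0 estimate; D1's hypotheses (the level-`m` KERNEL law `hWd`, the lock, the border ∕ Wilson letters) and the parity letters stay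
DISPLAYED; discharges NOTHING of `hcell` ∕ (Q-L) ∕ (C) ∕ «T2Shape» ∕ «T2Drift» ∕ (hW, hWall); (β) of record untouched; NEVER «G-an2-4 closed» as (CONV-C); NOT D1, NOT
`BetaPertH`, NOT continuum, NOT Clay.  2026-08-23.
-/

noncomputable section

open Finset
open scoped BigOperators
open Literature.MathematicalPhysics.QuantumFieldTheory
open Literature.MathematicalPhysics.QuantumFieldTheory.Balaban1983to89
open Literature.MathematicalPhysics.QuantumFieldTheory.Balaban1983to89.Beta
open ExpKernelCalculus (MKer Decays comp)
open OneStepResolventKernel (Fib)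
open OneStepKernelFamily (KInvStep)
open SecondOrderResponse (W2SymOfK dM)
open BalabanStepJetsSucc (mmRead wE wVH)
open BalabanStepW2 (K3OfK M2Of wV4 wB2)
open KernelWard (divV divW)
open AffineAveraging (box toSite)
open BalabanCompositeJets (LocStencil₂)
open AveragingMixedJetTables (mixFFAt)
open AveragingHessianKernelsRooted (vhSAt)
open StepJetData (wilsonA)
open WilsonBiStencil (wilsonW₂)
open Summit.QuantumFields.BalabanUV.Beta.TameKernelCalculus
open Summit.QuantumFields.BalabanUV.Beta.BorderedHessian (sgnK diagK)
open Summit.QuantumFields.BalabanUV.Beta.HessKerDressedUnits (unitK unitS)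
open Summit.QuantumFields.BalabanUV.Beta.SecondOrderUnits (unitM unitS₂ unitM₂)
open Summit.QuantumFields.BalabanUV.Beta.AxialDressingRooted (coDressKBmAt decays_coDressKBmAt_KInvStep)
open Summit.QuantumFields.BalabanUV.Beta.SpineRooted (T2RecAt SpureRecAt M1At WrecAt e3OfK)
open Summit.QuantumFields.BalabanUV.Beta.MixedJetTablesPlug (hmix_an1)
open Summit.QuantumFields.BalabanUV.Beta.ChartConjugation (conjV)
open Summit.QuantumFields.BalabanUV.Beta.AveragingWardRootedStencils (legInd)
open Summit.QuantumFields.BalabanUV.Beta.WardLocusQuarticTable (tableLaw_T2RecAt_succ tableLaw_T2RecAt_succ'' tableLaw_T2RecAt_zero tableLaw_T2RecAt_zero'')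
open Summit.QuantumFields.BalabanUV.Beta.BubbleParity (spr_of_decays trK_coDressKBmAt_KInvStep)
open Summit.QuantumFields.BalabanUV.Beta.KernelWardRemainderParity (parityOdd_add)
open Summit.QuantumFields.BalabanUV.Beta.SpineRecursiveParity (parityOdd_smul parityOdd_sum parityOdd_mmRead parityOdd_sandwich)
open Summit.QuantumFields.BalabanUV.Beta.SpineRecursivePureParity (trK_SpureRecAt)
open Summit.QuantumFields.BalabanUV.Beta.GAN24.CombesThomas (sfStep smStep)
open Summit.QuantumFields.BalabanUV.Beta.GAN24.BiStencilZeroMode (Tab)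
open Summit.QuantumFields.BalabanUV.Beta.GAN24.HalfMemberSlavedDivergence (parityEven_comm_of_oddRows)
open Summit.QuantumFields.BalabanUV.Beta.GAN24.HalfMemberSlavedDivergenceComb (divW_evenMember_succ_eq_slaved)

namespace Summit.QuantumFields.BalabanUV.Beta.GAN24.HalfMemberSlavedDivergencePin

variable {d : ℕ} {Lc : ℕ} [NeZero Lc] {r : Fin (d + 1) → ℕ}

/-! ## §4 The even member at D1's literal table laws: letters' parities discharged by name -/

/-- NOT IN PRINT; OUR BOOKKEEPING.  **THE EVEN MEMBER's SLAVED DIVERGENCE, LEVEL `m+1 → m+2`, AT D1's LITERAL** (pin; D1's `tableLaw_T2RecAt_succ ∕ ''` discharge the two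
table laws of the RAW member `T̃_{m+1}` under THEIR displayed hypotheses `h𝒩 hWd hlock hBord hBord''`; `cH′ ≠ 0`; parity letters `h𝒩par hRB hRB''`): the commutator
word survives (EVEN: `trK_SpureRecAt` ⨾ `parityEven_comm_of_oddRows`), the remainder `𝒩`-word + border remainder DROPS (ODD: `parityOdd_sandwich` ⨾ `parityOdd_mmRead` ⨾
`parityOdd_sum` ⨾ `parityOdd_smul` ⨾ `parityOdd_add`).  THE EVEN MEMBER's DIVERGENCE ONE LEVEL UP DOES NOT SEE THE WARD-LOCUS RESIDUAL. -/
theorem divW_evenMember_succ_succ_eq_slaved (hLc : 1 ≤ Lc) (hr : r ∈ box (d + 1) Lc) (cΛ cE₂ cB : ℝ) (Tc : Fin 4 → Fin 4 → Fin 4 → Fin 4 → ℝ)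
    {vh₂S : Tab d} (hBff : ∀ κ u κ' u' x z (α β : Fin (d + 1)), vh₂S κ u κ' u' x z (Sum.inl α) (Sum.inl β) = 0)
    (hBmm : ∀ κ u κ' u' x z (μ ν : Fin (d + 1)), vh₂S κ u κ' u' x z (Sum.inr μ) (Sum.inr ν) = 0)
    (hB : ∃ C δ : ℝ, 0 < δ ∧ LocStencil₂ vh₂S C δ) (m : ℕ)
    {𝒩 : (Fin (d + 1) → ℤ) → Fin (d + 1) → (Fin (d + 1) → ℤ) → MKer (d + 1) (Fib d)} (h𝒩 : ∀ y ν y', Loc (𝒩 y ν y'))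
    (h𝒩par : ∀ (y : Fin (d + 1) → ℤ) (ν : Fin (d + 1)) (y' : Fin (d + 1) → ℤ), trK (𝒩 y ν y') = -sgnK (𝒩 y ν y'))
    (hWd : ∀ (y : Fin (d + 1) → ℤ) (ν : Fin (d + 1)) (y' : Fin (d + 1) → ℤ),
      divW (WrecAt d Lc (toSite r) ((Lc : ℝ) ^ (d + 1)) (-((Lc : ℝ) ^ (d + 1) * (1 / 2) * (Lc : ℝ) ^ (d + 1))) cΛ cE₂ cB Tc vh₂S (mixFFAt (toSite r) Lc) m) y ν y' =
        conjV (dM (coDressKBmAt (toSite r) Lc (KInvStep (d := d) Lc m)) Lc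
            (SpureRecAt d Lc (toSite r) ((Lc : ℝ) ^ (d + 1)) (-((Lc : ℝ) ^ (d + 1) * (1 / 2) * (Lc : ℝ) ^ (d + 1))) cΛ m)
            (M1At d Lc (toSite r) cΛ m) ν y')
          (diagK (((1 : ℝ) / 2) • ∑ v ∈ box (d + 1) Lc, legInd (toSite r) ((Lc : ℤ) • y + toSite v))) + 𝒩 y ν y')
    {cH' : ℝ} (hcH : cH' ≠ 0) (hlock : cH' * (cE₂ * wV4 d Lc (m + 1)) * ((1 : ℝ) / 2) = ((Lc : ℝ) ^ (d + 1) * wE d Lc (m + 1)) * ((1 : ℝ) / 2))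
    {RB RB'' : (Fin (d + 1) → ℤ) → Fin (d + 1) → (Fin (d + 1) → ℤ) → MKer (d + 1) (Fib d)}
    (hBord : ∀ (Y : Fin (d + 1) → ℤ) (κ' : Fin (d + 1)) (u' : Fin (d + 1) → ℤ),
      cH' • ∑ v ∈ box (d + 1) Lc, divV (fun κ u => (cB * wB2 d Lc (m + 1)) • vh₂S κ u κ' u') ((Lc : ℤ) • Y + toSite v) =
        comp ((-((Lc : ℝ) ^ (d + 1) * (1 / 2) * (Lc : ℝ) ^ (d + 1)) * wVH d Lc (m + 1)) • vhSAt (toSite r) d Lc rfl κ' u')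
            (diagK (((1 : ℝ) / 2) • ∑ v ∈ box (d + 1) Lc, legInd (toSite r) ((Lc : ℤ) • Y + toSite v)))
          - comp (diagK (((1 : ℝ) / 2) • ∑ v ∈ box (d + 1) Lc, legInd (toSite r) ((Lc : ℤ) • Y + toSite v)))
            ((-((Lc : ℝ) ^ (d + 1) * (1 / 2) * (Lc : ℝ) ^ (d + 1)) * wVH d Lc (m + 1)) • vhSAt (toSite r) d Lc rfl κ' u')
          + RB Y κ' u')
    (hBord'' : ∀ (Y : Fin (d + 1) → ℤ) (κ : Fin (d + 1)) (u : Fin (d + 1) → ℤ),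
      cH' • ∑ v ∈ box (d + 1) Lc, divV (fun κ' u' => (cB * wB2 d Lc (m + 1)) • vh₂S κ u κ' u') ((Lc : ℤ) • Y + toSite v) =
        comp ((-((Lc : ℝ) ^ (d + 1) * (1 / 2) * (Lc : ℝ) ^ (d + 1)) * wVH d Lc (m + 1)) • vhSAt (toSite r) d Lc rfl κ u)
            (diagK (((1 : ℝ) / 2) • ∑ v ∈ box (d + 1) Lc, legInd (toSite r) ((Lc : ℤ) • Y + toSite v)))
          - comp (diagK (((1 : ℝ) / 2) • ∑ v ∈ box (d + 1) Lc, legInd (toSite r) ((Lc : ℤ) • Y + toSite v)))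
            ((-((Lc : ℝ) ^ (d + 1) * (1 / 2) * (Lc : ℝ) ^ (d + 1)) * wVH d Lc (m + 1)) • vhSAt (toSite r) d Lc rfl κ u)
          + RB'' Y κ u)
    (hRB : ∀ (Y : Fin (d + 1) → ℤ) (κ : Fin (d + 1)) (u : Fin (d + 1) → ℤ), trK (RB Y κ u) = -sgnK (RB Y κ u))
    (hRB'' : ∀ (Y : Fin (d + 1) → ℤ) (κ : Fin (d + 1)) (u : Fin (d + 1) → ℤ), trK (RB'' Y κ u) = -sgnK (RB'' Y κ u))
    (y : Fin (d + 1) → ℤ) (ν : Fin (d + 1)) (y' : Fin (d + 1) → ℤ) :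
    divW ((1 / 2 : ℝ) • (unitS₂ (sfStep Lc (m + 1 + 1)) (smStep d Lc (m + 1 + 1)) (T2RecAt d Lc (toSite r) ((Lc : ℝ) ^ (d + 1)) (-((Lc : ℝ) ^ (d + 1) * (1 / 2) * (Lc : ℝ) ^ (d + 1))) cΛ cE₂ cB Tc vh₂S (mixFFAt (toSite r) Lc) (m + 1 + 1))
          + fun κ u κ' u' => sgnK (trK (unitS₂ (sfStep Lc (m + 1 + 1)) (smStep d Lc (m + 1 + 1)) (T2RecAt d Lc (toSite r) ((Lc : ℝ) ^ (d + 1)) (-((Lc : ℝ) ^ (d + 1) * (1 / 2) * (Lc : ℝ) ^ (d + 1))) cΛ cE₂ cB Tc vh₂S (mixFFAt (toSite r) Lc) (m + 1 + 1)) κ u κ' u')))) y ν y'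
      = divW ((1 / 2 : ℝ) • ((fun κ u κ' u' => (cE₂ * (Lc : ℝ) ^ (2 * (d + 1))) • mmRead Lc (K3OfK
            (unitK (sfStep Lc (m + 1)) (smStep d Lc (m + 1)) (coDressKBmAt (toSite r) Lc (KInvStep (d := d) Lc (m + 1)))) Lc
            (unitS (sfStep Lc (m + 1)) (smStep d Lc (m + 1)) (SpureRecAt d Lc (toSite r) ((Lc : ℝ) ^ (d + 1)) (-((Lc : ℝ) ^ (d + 1) * (1 / 2) * (Lc : ℝ) ^ (d + 1))) cΛ (m + 1))) (unitM (sfStep Lc (m + 1)) (smStep d Lc (m + 1)) (M1At d Lc (toSite r) cΛ (m + 1)))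
            (W2SymOfK (unitK (sfStep Lc (m + 1)) (smStep d Lc (m + 1)) (coDressKBmAt (toSite r) Lc (KInvStep (d := d) Lc (m + 1)))) Lc
              (unitS (sfStep Lc (m + 1)) (smStep d Lc (m + 1)) (SpureRecAt d Lc (toSite r) ((Lc : ℝ) ^ (d + 1)) (-((Lc : ℝ) ^ (d + 1) * (1 / 2) * (Lc : ℝ) ^ (d + 1))) cΛ (m + 1))) (unitM (sfStep Lc (m + 1)) (smStep d Lc (m + 1)) (M1At d Lc (toSite r) cΛ (m + 1))) 0
              (unitM₂ (sfStep Lc (m + 1)) (smStep d Lc (m + 1)) (M2Of d Lc (mixFFAt (toSite r) Lc) (m + 1)))) κ u κ' u') + cB • vh₂S κ u κ' u')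
          + fun κ u κ' u' => sgnK (trK ((fun κ u κ' u' => (cE₂ * (Lc : ℝ) ^ (2 * (d + 1))) • mmRead Lc (K3OfK
            (unitK (sfStep Lc (m + 1)) (smStep d Lc (m + 1)) (coDressKBmAt (toSite r) Lc (KInvStep (d := d) Lc (m + 1)))) Lc
            (unitS (sfStep Lc (m + 1)) (smStep d Lc (m + 1)) (SpureRecAt d Lc (toSite r) ((Lc : ℝ) ^ (d + 1)) (-((Lc : ℝ) ^ (d + 1) * (1 / 2) * (Lc : ℝ) ^ (d + 1))) cΛ (m + 1))) (unitM (sfStep Lc (m + 1)) (smStep d Lc (m + 1)) (M1At d Lc (toSite r) cΛ (m + 1)))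
            (W2SymOfK (unitK (sfStep Lc (m + 1)) (smStep d Lc (m + 1)) (coDressKBmAt (toSite r) Lc (KInvStep (d := d) Lc (m + 1)))) Lc
              (unitS (sfStep Lc (m + 1)) (smStep d Lc (m + 1)) (SpureRecAt d Lc (toSite r) ((Lc : ℝ) ^ (d + 1)) (-((Lc : ℝ) ^ (d + 1) * (1 / 2) * (Lc : ℝ) ^ (d + 1))) cΛ (m + 1))) (unitM (sfStep Lc (m + 1)) (smStep d Lc (m + 1)) (M1At d Lc (toSite r) cΛ (m + 1))) 0
              (unitM₂ (sfStep Lc (m + 1)) (smStep d Lc (m + 1)) (M2Of d Lc (mixFFAt (toSite r) Lc) (m + 1)))) κ u κ' u') + cB • vh₂S κ u κ' u') κ u κ' u')))) y ν y'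
        + (cE₂ * (Lc : ℝ) ^ (2 * (d + 1)) * ((Lc : ℝ) ^ (d + 1))⁻¹ / 2) •
          (e3OfK Lc (unitK (sfStep Lc (m + 1)) (smStep d Lc (m + 1)) (coDressKBmAt (toSite r) Lc (KInvStep (d := d) Lc (m + 1))))
              (fun κ' u' => (sfStep Lc (m + 1) * smStep d Lc (m + 1))⁻¹ • unitS (sfStep Lc (m + 1)) (smStep d Lc (m + 1))
                (fun κ' u' => cH'⁻¹ • (comp (SpureRecAt d Lc (toSite r) ((Lc : ℝ) ^ (d + 1)) (-((Lc : ℝ) ^ (d + 1) * (1 / 2) * (Lc : ℝ) ^ (d + 1))) cΛ (m + 1) κ' u') (diagK (((1 : ℝ) / 2) • ∑ v ∈ box (d + 1) Lc, legInd (toSite r) ((Lc : ℤ) • y + toSite v))) - comp (diagK (((1 : ℝ) / 2) • ∑ v ∈ box (d + 1) Lc, legInd (toSite r) ((Lc : ℤ) • y + toSite v))) (SpureRecAt d Lc (toSite r) ((Lc : ℝ) ^ (d + 1)) (-((Lc : ℝ) ^ (d + 1) * (1 / 2) * (Lc : ℝ) ^ (d + 1))) cΛ (m + 1) κ' u')))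 κ' u') ν y'
            + e3OfK Lc (unitK (sfStep Lc (m + 1)) (smStep d Lc (m + 1)) (coDressKBmAt (toSite r) Lc (KInvStep (d := d) Lc (m + 1))))
              (fun κ u => (sfStep Lc (m + 1) * smStep d Lc (m + 1))⁻¹ • unitS (sfStep Lc (m + 1)) (smStep d Lc (m + 1))
                (fun κ u => cH'⁻¹ • (comp (SpureRecAt d Lc (toSite r) ((Lc : ℝ) ^ (d + 1)) (-((Lc : ℝ) ^ (d + 1) * (1 / 2) * (Lc : ℝ) ^ (d + 1))) cΛ (m + 1) κ u) (diagK (((1 : ℝ) / 2) • ∑ v ∈ box (d + 1) Lc, legInd (toSite r) ((Lc : ℤ) • y + toSite v))) - comp (diagK (((1 : ℝ) / 2) • ∑ v ∈ box (d + 1) Lc, legInd (toSite r) ((Lc : ℤ) • y + toSite v))) (SpureRecAt d Lc (toSite r) ((Lc : ℝ) ^ (d + 1)) (-((Lc : ℝ) ^ (d + 1) * (1 / 2) * (Lc : ℝ) ^ (d + 1))) cΛ (m + 1) κ u))) κ u) ν y') := by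
  have hKs := spr_of_decays (decays_coDressKBmAt_KInvStep (d := d) hr m)
  have hKt := trK_coDressKBmAt_KInvStep (d := d) hr m
  -- the commutator word is EVEN (odd-rowed `SpureRecAt`), the remainders are ODD (`𝒩` odd in an even sandwich; border letters)
  have hC : ∀ (Y : Fin (d + 1) → ℤ) (κ : Fin (d + 1)) (u : Fin (d + 1) → ℤ),
      trK (comp (SpureRecAt d Lc (toSite r) ((Lc : ℝ) ^ (d + 1)) (-((Lc : ℝ) ^ (d + 1) * (1 / 2) * (Lc : ℝ) ^ (d + 1))) cΛ (m + 1) κ u) (diagK (((1 : ℝ) / 2) • ∑ v ∈ box (d + 1) Lc, legInd (toSite r) ((Lc : ℤ) • Y + toSite v)))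
          - comp (diagK (((1 : ℝ) / 2) • ∑ v ∈ box (d + 1) Lc, legInd (toSite r) ((Lc : ℤ) • Y + toSite v))) (SpureRecAt d Lc (toSite r) ((Lc : ℝ) ^ (d + 1)) (-((Lc : ℝ) ^ (d + 1) * (1 / 2) * (Lc : ℝ) ^ (d + 1))) cΛ (m + 1) κ u))
        = sgnK (comp (SpureRecAt d Lc (toSite r) ((Lc : ℝ) ^ (d + 1)) (-((Lc : ℝ) ^ (d + 1) * (1 / 2) * (Lc : ℝ) ^ (d + 1))) cΛ (m + 1) κ u) (diagK (((1 : ℝ) / 2) • ∑ v ∈ box (d + 1) Lc, legInd (toSite r) ((Lc : ℤ) • Y + toSite v)))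
          - comp (diagK (((1 : ℝ) / 2) • ∑ v ∈ box (d + 1) Lc, legInd (toSite r) ((Lc : ℤ) • Y + toSite v))) (SpureRecAt d Lc (toSite r) ((Lc : ℝ) ^ (d + 1)) (-((Lc : ℝ) ^ (d + 1) * (1 / 2) * (Lc : ℝ) ^ (d + 1))) cΛ (m + 1) κ u)) :=
    fun Y κ u => parityEven_comm_of_oddRows (trK_SpureRecAt hLc hr _ _ _ (m + 1))
      (fun Y => ((1 : ℝ) / 2) • ∑ v ∈ box (d + 1) Lc, legInd (toSite r) ((Lc : ℤ) • Y + toSite v)) Y κ u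
  have hR : ∀ (Y : Fin (d + 1) → ℤ) (κ : Fin (d + 1)) (u : Fin (d + 1) → ℤ),
      trK ((-(cH' * (cE₂ * wV4 d Lc (m + 1)))) • ∑ v ∈ box (d + 1) Lc,
              mmRead Lc (comp (comp (coDressKBmAt (toSite r) Lc (KInvStep (d := d) Lc m)) (𝒩 ((Lc : ℤ) • Y + toSite v) κ u))
                (coDressKBmAt (toSite r) Lc (KInvStep (d := d) Lc m))) + RB Y κ u)
        = -sgnK ((-(cH' * (cE₂ * wV4 d Lc (m + 1)))) • ∑ v ∈ box (d + 1) Lc,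
              mmRead Lc (comp (comp (coDressKBmAt (toSite r) Lc (KInvStep (d := d) Lc m)) (𝒩 ((Lc : ℤ) • Y + toSite v) κ u))
                (coDressKBmAt (toSite r) Lc (KInvStep (d := d) Lc m))) + RB Y κ u) :=
    fun Y κ u => parityOdd_add (parityOdd_smul _ (parityOdd_sum _ fun v _ =>
      parityOdd_mmRead Lc (parityOdd_sandwich hKs (h𝒩 _ κ u) hKt (h𝒩par _ κ u)))) (hRB Y κ u)
  have hR'' : ∀ (Y : Fin (d + 1) → ℤ) (κ : Fin (d + 1)) (u : Fin (d + 1) → ℤ),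
      trK ((-(cH' * (cE₂ * wV4 d Lc (m + 1)))) • ∑ v ∈ box (d + 1) Lc,
              mmRead Lc (comp (comp (coDressKBmAt (toSite r) Lc (KInvStep (d := d) Lc m)) (𝒩 ((Lc : ℤ) • Y + toSite v) κ u))
                (coDressKBmAt (toSite r) Lc (KInvStep (d := d) Lc m))) + RB'' Y κ u)
        = -sgnK ((-(cH' * (cE₂ * wV4 d Lc (m + 1)))) • ∑ v ∈ box (d + 1) Lc,
              mmRead Lc (comp (comp (coDressKBmAt (toSite r) Lc (KInvStep (d := d) Lc m)) (𝒩 ((Lc : ℤ) • Y + toSite v) κ u))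
                (coDressKBmAt (toSite r) Lc (KInvStep (d := d) Lc m))) + RB'' Y κ u) :=
    fun Y κ u => parityOdd_add (parityOdd_smul _ (parityOdd_sum _ fun v _ =>
      parityOdd_mmRead Lc (parityOdd_sandwich hKs (h𝒩 _ κ u) hKt (h𝒩par _ κ u)))) (hRB'' Y κ u)
  exact divW_evenMember_succ_eq_slaved hLc hr ((Lc : ℝ) ^ (d + 1)) (-((Lc : ℝ) ^ (d + 1) * (1 / 2) * (Lc : ℝ) ^ (d + 1))) cΛ cE₂ cB Tc
    hBff hBmm hB (m + 1)
    (X := fun Y => diagK (((1 : ℝ) / 2) • ∑ v ∈ box (d + 1) Lc, legInd (toSite r) ((Lc : ℤ) • Y + toSite v)))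
    (R := fun Y κ u => (-(cH' * (cE₂ * wV4 d Lc (m + 1)))) • ∑ v ∈ box (d + 1) Lc,
              mmRead Lc (comp (comp (coDressKBmAt (toSite r) Lc (KInvStep (d := d) Lc m)) (𝒩 ((Lc : ℤ) • Y + toSite v) κ u))
                (coDressKBmAt (toSite r) Lc (KInvStep (d := d) Lc m))) + RB Y κ u)
    (R'' := fun Y κ u => (-(cH' * (cE₂ * wV4 d Lc (m + 1)))) • ∑ v ∈ box (d + 1) Lc,
              mmRead Lc (comp (comp (coDressKBmAt (toSite r) Lc (KInvStep (d := d) Lc m)) (𝒩 ((Lc : ℤ) • Y + toSite v) κ u))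
                (coDressKBmAt (toSite r) Lc (KInvStep (d := d) Lc m))) + RB'' Y κ u)
    hcH
    (tableLaw_T2RecAt_succ hLc hr cΛ cE₂ cB Tc hB (hmix_an1 hLc hr) m h𝒩 hWd hlock hBord)
    (tableLaw_T2RecAt_succ'' hLc hr cΛ cE₂ cB Tc hB (hmix_an1 hLc hr) m h𝒩 hWd hlock hBord'')
    hC hR hR'' y ν y'

/-- NOT IN PRINT; OUR BOOKKEEPING.  **THE EVEN MEMBER's SLAVED DIVERGENCE, LEVEL `0 → 1`, AT D1's LITERAL** (pin; D1's `tableLaw_T2RecAt_zero ∕ ''` from the WILSON letters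
`hWil ∕ hWil''` and the BORDER letters `hBord ∕ hBord''`, displayed verbatim; `cH′ ≠ 0`; parity letters `hRW hRB hRW'' hRB''` of the four remainders): the commutator word
with `S_0` survives, the remainders drop. -/
theorem divW_evenMember_one_eq_slaved (hLc : 1 ≤ Lc) (hr : r ∈ box (d + 1) Lc) (cΛ cE₂ cB : ℝ) (Tc : Fin 4 → Fin 4 → Fin 4 → Fin 4 → ℝ)
    {vh₂S : Tab d} (hBff : ∀ κ u κ' u' x z (α β : Fin (d + 1)), vh₂S κ u κ' u' x z (Sum.inl α) (Sum.inl β) = 0)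
    (hBmm : ∀ κ u κ' u' x z (μ ν : Fin (d + 1)), vh₂S κ u κ' u' x z (Sum.inr μ) (Sum.inr ν) = 0)
    (hB : ∃ C δ : ℝ, 0 < δ ∧ LocStencil₂ vh₂S C δ) {cH' : ℝ} (hcH : cH' ≠ 0)
    {RW RB RW'' RB'' : (Fin (d + 1) → ℤ) → Fin (d + 1) → (Fin (d + 1) → ℤ) → MKer (d + 1) (Fib d)}
    (hWil : ∀ (Y : Fin (d + 1) → ℤ) (κ' : Fin (d + 1)) (u' : Fin (d + 1) → ℤ),
      cH' • ∑ v ∈ box (d + 1) Lc, divV (fun κ u => cE₂ • wilsonW₂ d Tc κ u κ' u') ((Lc : ℤ) • Y + toSite v) =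
        comp (((Lc : ℝ) ^ (d + 1)) • wilsonA d κ' u') (diagK (((1 : ℝ) / 2) • ∑ v ∈ box (d + 1) Lc, legInd (toSite r) ((Lc : ℤ) • Y + toSite v)))
          - comp (diagK (((1 : ℝ) / 2) • ∑ v ∈ box (d + 1) Lc, legInd (toSite r) ((Lc : ℤ) • Y + toSite v))) (((Lc : ℝ) ^ (d + 1)) • wilsonA d κ' u')
          + RW Y κ' u')
    (hBord : ∀ (Y : Fin (d + 1) → ℤ) (κ' : Fin (d + 1)) (u' : Fin (d + 1) → ℤ),
      cH' • ∑ v ∈ box (d + 1) Lc, divV (fun κ u => cB • vh₂S κ u κ' u') ((Lc : ℤ) • Y + toSite v) =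
        comp ((-((Lc : ℝ) ^ (d + 1) * (1 / 2) * (Lc : ℝ) ^ (d + 1))) • vhSAt (toSite r) d Lc rfl κ' u')
            (diagK (((1 : ℝ) / 2) • ∑ v ∈ box (d + 1) Lc, legInd (toSite r) ((Lc : ℤ) • Y + toSite v)))
          - comp (diagK (((1 : ℝ) / 2) • ∑ v ∈ box (d + 1) Lc, legInd (toSite r) ((Lc : ℤ) • Y + toSite v)))
            ((-((Lc : ℝ) ^ (d + 1) * (1 / 2) * (Lc : ℝ) ^ (d + 1))) • vhSAt (toSite r) d Lc rfl κ' u')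
          + RB Y κ' u')
    (hWil'' : ∀ (Y : Fin (d + 1) → ℤ) (κ : Fin (d + 1)) (u : Fin (d + 1) → ℤ),
      cH' • ∑ v ∈ box (d + 1) Lc, divV (fun κ' u' => cE₂ • wilsonW₂ d Tc κ u κ' u') ((Lc : ℤ) • Y + toSite v) =
        comp (((Lc : ℝ) ^ (d + 1)) • wilsonA d κ u) (diagK (((1 : ℝ) / 2) • ∑ v ∈ box (d + 1) Lc, legInd (toSite r) ((Lc : ℤ) • Y + toSite v)))
          - comp (diagK (((1 : ℝ) / 2) • ∑ v ∈ box (d + 1) Lc, legInd (toSite r) ((Lc : ℤ) • Y + toSite v))) (((Lc : ℝ) ^ (d + 1)) • wilsonA d κ u)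
          + RW'' Y κ u)
    (hBord'' : ∀ (Y : Fin (d + 1) → ℤ) (κ : Fin (d + 1)) (u : Fin (d + 1) → ℤ),
      cH' • ∑ v ∈ box (d + 1) Lc, divV (fun κ' u' => cB • vh₂S κ u κ' u') ((Lc : ℤ) • Y + toSite v) =
        comp ((-((Lc : ℝ) ^ (d + 1) * (1 / 2) * (Lc : ℝ) ^ (d + 1))) • vhSAt (toSite r) d Lc rfl κ u)
            (diagK (((1 : ℝ) / 2) • ∑ v ∈ box (d + 1) Lc, legInd (toSite r) ((Lc : ℤ) • Y + toSite v)))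
          - comp (diagK (((1 : ℝ) / 2) • ∑ v ∈ box (d + 1) Lc, legInd (toSite r) ((Lc : ℤ) • Y + toSite v)))
            ((-((Lc : ℝ) ^ (d + 1) * (1 / 2) * (Lc : ℝ) ^ (d + 1))) • vhSAt (toSite r) d Lc rfl κ u)
          + RB'' Y κ u)
    (hRW : ∀ (Y : Fin (d + 1) → ℤ) (κ : Fin (d + 1)) (u : Fin (d + 1) → ℤ), trK (RW Y κ u) = -sgnK (RW Y κ u))
    (hRB : ∀ (Y : Fin (d + 1) → ℤ) (κ : Fin (d + 1)) (u : Fin (d + 1) → ℤ), trK (RB Y κ u) = -sgnK (RB Y κ u))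
    (hRW'' : ∀ (Y : Fin (d + 1) → ℤ) (κ : Fin (d + 1)) (u : Fin (d + 1) → ℤ), trK (RW'' Y κ u) = -sgnK (RW'' Y κ u))
    (hRB'' : ∀ (Y : Fin (d + 1) → ℤ) (κ : Fin (d + 1)) (u : Fin (d + 1) → ℤ), trK (RB'' Y κ u) = -sgnK (RB'' Y κ u))
    (y : Fin (d + 1) → ℤ) (ν : Fin (d + 1)) (y' : Fin (d + 1) → ℤ) :
    divW ((1 / 2 : ℝ) • (unitS₂ (sfStep Lc (0 + 1)) (smStep d Lc (0 + 1)) (T2RecAt d Lc (toSite r) ((Lc : ℝ) ^ (d + 1)) (-((Lc : ℝ) ^ (d + 1) * (1 / 2) * (Lc : ℝ) ^ (d + 1))) cΛ cE₂ cB Tc vh₂S (mixFFAt (toSite r) Lc) (0 + 1))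
          + fun κ u κ' u' => sgnK (trK (unitS₂ (sfStep Lc (0 + 1)) (smStep d Lc (0 + 1)) (T2RecAt d Lc (toSite r) ((Lc : ℝ) ^ (d + 1)) (-((Lc : ℝ) ^ (d + 1) * (1 / 2) * (Lc : ℝ) ^ (d + 1))) cΛ cE₂ cB Tc vh₂S (mixFFAt (toSite r) Lc) (0 + 1)) κ u κ' u')))) y ν y'
      = divW ((1 / 2 : ℝ) • ((fun κ u κ' u' => (cE₂ * (Lc : ℝ) ^ (2 * (d + 1))) • mmRead Lc (K3OfK
            (unitK (sfStep Lc 0) (smStep d Lc 0) (coDressKBmAt (toSite r) Lc (KInvStep (d := d) Lc 0))) Lc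
            (unitS (sfStep Lc 0) (smStep d Lc 0) (SpureRecAt d Lc (toSite r) ((Lc : ℝ) ^ (d + 1)) (-((Lc : ℝ) ^ (d + 1) * (1 / 2) * (Lc : ℝ) ^ (d + 1))) cΛ 0)) (unitM (sfStep Lc 0) (smStep d Lc 0) (M1At d Lc (toSite r) cΛ 0))
            (W2SymOfK (unitK (sfStep Lc 0) (smStep d Lc 0) (coDressKBmAt (toSite r) Lc (KInvStep (d := d) Lc 0))) Lc
              (unitS (sfStep Lc 0) (smStep d Lc 0) (SpureRecAt d Lc (toSite r) ((Lc : ℝ) ^ (d + 1)) (-((Lc : ℝ) ^ (d + 1) * (1 / 2) * (Lc : ℝ) ^ (d + 1))) cΛ 0)) (unitM (sfStep Lc 0) (smStep d Lc 0) (M1At d Lc (toSite r) cΛ 0)) 0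
              (unitM₂ (sfStep Lc 0) (smStep d Lc 0) (M2Of d Lc (mixFFAt (toSite r) Lc) 0))) κ u κ' u') + cB • vh₂S κ u κ' u')
          + fun κ u κ' u' => sgnK (trK ((fun κ u κ' u' => (cE₂ * (Lc : ℝ) ^ (2 * (d + 1))) • mmRead Lc (K3OfK
            (unitK (sfStep Lc 0) (smStep d Lc 0) (coDressKBmAt (toSite r) Lc (KInvStep (d := d) Lc 0))) Lc
            (unitS (sfStep Lc 0) (smStep d Lc 0) (SpureRecAt d Lc (toSite r) ((Lc : ℝ) ^ (d + 1)) (-((Lc : ℝ) ^ (d + 1) * (1 / 2) * (Lc : ℝ) ^ (d + 1))) cΛ 0)) (unitM (sfStep Lc 0) (smStep d Lc 0) (M1At d Lc (toSite r) cΛ 0))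
            (W2SymOfK (unitK (sfStep Lc 0) (smStep d Lc 0) (coDressKBmAt (toSite r) Lc (KInvStep (d := d) Lc 0))) Lc
              (unitS (sfStep Lc 0) (smStep d Lc 0) (SpureRecAt d Lc (toSite r) ((Lc : ℝ) ^ (d + 1)) (-((Lc : ℝ) ^ (d + 1) * (1 / 2) * (Lc : ℝ) ^ (d + 1))) cΛ 0)) (unitM (sfStep Lc 0) (smStep d Lc 0) (M1At d Lc (toSite r) cΛ 0)) 0
              (unitM₂ (sfStep Lc 0) (smStep d Lc 0) (M2Of d Lc (mixFFAt (toSite r) Lc) 0))) κ u κ' u') + cB • vh₂S κ u κ' u') κ u κ' u')))) y ν y'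
        + (cE₂ * (Lc : ℝ) ^ (2 * (d + 1)) * ((Lc : ℝ) ^ (d + 1))⁻¹ / 2) •
          (e3OfK Lc (unitK (sfStep Lc 0) (smStep d Lc 0) (coDressKBmAt (toSite r) Lc (KInvStep (d := d) Lc 0)))
              (fun κ' u' => (sfStep Lc 0 * smStep d Lc 0)⁻¹ • unitS (sfStep Lc 0) (smStep d Lc 0)
                (fun κ' u' => cH'⁻¹ • (comp (SpureRecAt d Lc (toSite r) ((Lc : ℝ) ^ (d + 1)) (-((Lc : ℝ) ^ (d + 1) * (1 / 2) * (Lc : ℝ) ^ (d + 1))) cΛ 0 κ' u') (diagK (((1 : ℝ) / 2) • ∑ v ∈ box (d + 1) Lc, legInd (toSite r) ((Lc : ℤ) • y + toSite v))) - comp (diagK (((1 : ℝ) / 2) • ∑ v ∈ box (d + 1) Lc, legInd (toSite r) ((Lc : ℤ) • y + toSite v))) (SpureRecAt d Lc (toSite r) ((Lc : ℝ) ^ (d + 1)) (-((Lc : ℝ) ^ (d + 1) * (1 / 2) * (Lc : ℝ) ^ (d + 1))) cΛ 0 κ' u'))) κ' u') ν y'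
            + e3OfK Lc (unitK (sfStep Lc 0) (smStep d Lc 0) (coDressKBmAt (toSite r) Lc (KInvStep (d := d) Lc 0)))
              (fun κ u => (sfStep Lc 0 * smStep d Lc 0)⁻¹ • unitS (sfStep Lc 0) (smStep d Lc 0)
                (fun κ u => cH'⁻¹ • (comp (SpureRecAt d Lc (toSite r) ((Lc : ℝ) ^ (d + 1)) (-((Lc : ℝ) ^ (d + 1) * (1 / 2) * (Lc : ℝ) ^ (d + 1))) cΛ 0 κ u) (diagK (((1 : ℝ) / 2) • ∑ v ∈ box (d + 1) Lc, legInd (toSite r) ((Lc : ℤ) • y + toSite v))) - comp (diagK (((1 : ℝ) / 2) • ∑ v ∈ box (d + 1) Lc, legInd (toSite r) ((Lc : ℤ) • y + toSite v))) (SpureRecAt d Lc (toSite r) ((Lc : ℝ) ^ (d + 1)) (-((Lc : ℝ) ^ (d + 1) * (1 / 2) * (Lc : ℝ) ^ (d + 1))) cΛ 0 κ u))) κ u) ν y') := by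
  have hC : ∀ (Y : Fin (d + 1) → ℤ) (κ : Fin (d + 1)) (u : Fin (d + 1) → ℤ),
      trK (comp (SpureRecAt d Lc (toSite r) ((Lc : ℝ) ^ (d + 1)) (-((Lc : ℝ) ^ (d + 1) * (1 / 2) * (Lc : ℝ) ^ (d + 1))) cΛ 0 κ u) (diagK (((1 : ℝ) / 2) • ∑ v ∈ box (d + 1) Lc, legInd (toSite r) ((Lc : ℤ) • Y + toSite v)))
          - comp (diagK (((1 : ℝ) / 2) • ∑ v ∈ box (d + 1) Lc, legInd (toSite r) ((Lc : ℤ) • Y + toSite v))) (SpureRecAt d Lc (toSite r) ((Lc : ℝ) ^ (d + 1)) (-((Lc : ℝ) ^ (d + 1) * (1 / 2) * (Lc : ℝ) ^ (d + 1))) cΛ 0 κ u))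
        = sgnK (comp (SpureRecAt d Lc (toSite r) ((Lc : ℝ) ^ (d + 1)) (-((Lc : ℝ) ^ (d + 1) * (1 / 2) * (Lc : ℝ) ^ (d + 1))) cΛ 0 κ u) (diagK (((1 : ℝ) / 2) • ∑ v ∈ box (d + 1) Lc, legInd (toSite r) ((Lc : ℤ) • Y + toSite v)))
          - comp (diagK (((1 : ℝ) / 2) • ∑ v ∈ box (d + 1) Lc, legInd (toSite r) ((Lc : ℤ) • Y + toSite v))) (SpureRecAt d Lc (toSite r) ((Lc : ℝ) ^ (d + 1)) (-((Lc : ℝ) ^ (d + 1) * (1 / 2) * (Lc : ℝ) ^ (d + 1))) cΛ 0 κ u)) :=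
    fun Y κ u => parityEven_comm_of_oddRows (trK_SpureRecAt hLc hr _ _ _ 0)
      (fun Y => ((1 : ℝ) / 2) • ∑ v ∈ box (d + 1) Lc, legInd (toSite r) ((Lc : ℤ) • Y + toSite v)) Y κ u
  exact divW_evenMember_succ_eq_slaved hLc hr ((Lc : ℝ) ^ (d + 1)) (-((Lc : ℝ) ^ (d + 1) * (1 / 2) * (Lc : ℝ) ^ (d + 1))) cΛ cE₂ cB Tc
    hBff hBmm hB 0
    (X := fun Y => diagK (((1 : ℝ) / 2) • ∑ v ∈ box (d + 1) Lc, legInd (toSite r) ((Lc : ℤ) • Y + toSite v)))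
    (R := fun Y κ u => RW Y κ u + RB Y κ u) (R'' := fun Y κ u => RW'' Y κ u + RB'' Y κ u)
    hcH
    (tableLaw_T2RecAt_zero cΛ cE₂ cB Tc vh₂S (mixFFAt (toSite r) Lc) hWil hBord)
    (tableLaw_T2RecAt_zero'' cΛ cE₂ cB Tc vh₂S (mixFFAt (toSite r) Lc) hWil'' hBord'')
    hC (fun Y κ u => parityOdd_add (hRW Y κ u) (hRB Y κ u)) (fun Y κ u => parityOdd_add (hRW'' Y κ u) (hRB'' Y κ u)) y ν y'

end Summit.QuantumFields.BalabanUV.Beta.GAN24.HalfMemberSlavedDivergencePin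

end
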